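import Summits.MatrixMultiplication.OmegaCensus.DominoZpZpCells
import Summits.MatrixMultiplication.OmegaCensus.DominoZ17StructSixRows3
import Summits.MatrixMultiplication.OmegaCensus.DominoZ17StructSixPairsA
import Summits.MatrixMultiplication.OmegaCensus.DominoZ17StructSixPairsB
import Summits.MatrixMultiplication.OmegaCensus.DominoZ17StructSixPairsC
import Summits.MatrixMultiplication.OmegaCensus.DominoZ17StructSixArrA
import Summits.MatrixMultiplication.OmegaCensus.DominoZ17StructSixArrB
import Summits.MatrixMultiplication.OmegaCensus.DominoZ17StructSixArrC
import Summits.MatrixMultiplication.OmegaCensus.DominoZ17Z17Cells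
import HarnessLib

/-!
# No domino cube law with a part of size `6` over any `A ↠ ℤ_17 × ℤ_17` (structural route without the pigeonhole)

ω-census `pub-omega`, family (b3), seat pub-omega-group gen 25.  Framing: lottery ticket; floor = certified bounds/negative
ranges.  VALUE: per-prime kernel data of the structural part-`6` route WITHOUT the pigeonhole (`DominoZpZpStructSixWide*.lean`)
for `p = 17` — target: the OPEN census cell `(1,6,16)@289` (`A = ℤ₁₇²`) and every larger order with such a quotient; NOT progress on ω.

Assembly: `exists_entry_structSixWide_of_checks` (`DominoZpZpStructSixWide.lean`) with the decides of
`DominoZ17StructSixData/ArrA/ArrB/ArrC/PairsA/PairsB/PairsC/Rows1/Rows2.lean` (5572 certified keys); cells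
`no_law_cube_16e_of_onto_z17z17` / `no_law_cube_1d6_of_onto_z17z17` = no `(1,1 | 6,6 | e,e)` law triple, either order, any `e`,
in any dihedral-like group (any `c₀`) over ANY finite abelian `A ↠ ℤ_17 × ℤ_17` — census cell `(1,6,16)@289` (`A = ℤ₁₇²`).
-/

namespace Summit.MatrixMultiplication.OmegaCensus

open Finset ZpZpDomino Literature.Combinatorics.Additive

namespace ZpZpDomino

/-- **Every value function of sum `6` on `ZMod 17 × ZMod 17` has a line direction whose count vector is, up to a unit scaling,
a certified entry of `tableZ17s6v`** (structural part-`6` route, no pigeonhole). [folklore] -/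
theorem exists_table_entry_17_6s (g : Fin (17 * 17) → ℕ) (hg : ∑ i, g i = 6)
    (_hNF : (1 ≤ g ⟨17, by decide⟩ ∧ 1 ≤ g ⟨1, by decide⟩) ∨
      (1 ≤ g ⟨17, by decide⟩ ∧ ∀ i : Fin (17 * 17), i.val % 17 ≠ 0 → g i = 0) ∨ (∀ i : Fin (17 * 17), i.val ≠ 0 → g i = 0)) :
    ∃ j < 17 + 1, ∃ k : ℕ, k % 17 ≠ 0 ∧ ∃ e ∈ tableZ17s6v, ∀ v < 17,
      e.1.getD (k * v % 17) 0 = ∑ i : Fin (17 * 17), pick v (pv 17 j i.val) (g i) :=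
  haveI : Fact (Nat.Prime 17) := ⟨by decide⟩
  exists_entry_structSixWide_of_checks eZ17s6v rZ17s6 3 etZ17s6 ysaZ17s6 ysbZ17s6 yscZ17s6 checkE1six_17 checkE2g6_17
    checkR6_17 etZ17s6_complete hysaZ17s6 hysbZ17s6 hyscZ17s6 checkH6a_17 checkH6b_17 checkH6c_17 tableZ17s6v tabTreeZ17s6v
    (fun _ h => mem_tabTree h) tableZ17s6v_wf checkEwf6_17 etZ17s6_sound checkSixv_17 g hg

end ZpZpDomino

variable {A : Type} [AddCommGroup A] [DecidableEq A] [Fintype A] {G : Type} [Group G] [DecidableEq G]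
  {ρ τ : A → G} {c₀ : A} {S T U : Finset G}

/-- **No `(1,1 | 6,6 | e,e)` law triple over `A ↠ ℤ_17 × ℤ_17`** (dihedral-like `G`, any `c₀`, `φ` onto). [folklore] -/
theorem no_law_cube_16e_of_onto_z17z17
    (hρρ : ∀ a b, ρ a * ρ b = ρ (a + b)) (hρτ : ∀ a b, ρ a * τ b = τ (b - a))
    (hτρ : ∀ a b, τ a * ρ b = τ (a + b)) (hττ : ∀ a b, τ a * τ b = ρ (c₀ + b - a))
    (hρ : Function.Injective ρ) (hτ : Function.Injective τ) (hne : ∀ a b, ρ a ≠ τ b)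
    (hsurj : ∀ g, (∃ a, ρ a = g) ∨ (∃ a, τ a = g))
    (φ : A →+ ZMod 17 × ZMod 17) (hφ : Function.Surjective φ)
    (h : TripleProductProperty S T U)
    (hS₀ : (univ.filter fun a : A => ρ a ∈ S).card = 1) (hS₁ : (univ.filter fun a : A => τ a ∈ S).card = 1)
    (hT₀ : (univ.filter fun a : A => ρ a ∈ T).card = 6) (hT₁ : (univ.filter fun a : A => τ a ∈ T).card = 6)
    (hU : (univ.filter fun a : A => ρ a ∈ U).card = (univ.filter fun a : A => τ a ∈ U).card)
    (hV : 3 * (S.card * T.card * U.card) + 8 = 8 * Fintype.card A) : False :=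
  haveI : Fact (Nat.Prime 17) := ⟨by decide⟩
  no_law_cube_1de_of_onto_zpzp_of_cover (9 : ZMod 17) half_zmod17 tableZ17s6v tableZ17s6v_cert ⟨17, by decide⟩ ⟨1, by decide⟩
    rfl rfl exists_table_entry_17_6s hρρ hρτ hτρ hττ hρ hτ hne hsurj φ hφ h hS₀ hS₁ hT₀ hT₁ hU hV

/-- **No `(1,1 | d,d | 6,6)` law triple over `A ↠ ℤ_17 × ℤ_17`** (dihedral-like `G`, any `c₀`, `φ` onto). [folklore] -/
theorem no_law_cube_1d6_of_onto_z17z17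
    (hρρ : ∀ a b, ρ a * ρ b = ρ (a + b)) (hρτ : ∀ a b, ρ a * τ b = τ (b - a))
    (hτρ : ∀ a b, τ a * ρ b = τ (a + b)) (hττ : ∀ a b, τ a * τ b = ρ (c₀ + b - a))
    (hρ : Function.Injective ρ) (hτ : Function.Injective τ) (hne : ∀ a b, ρ a ≠ τ b)
    (hsurj : ∀ g, (∃ a, ρ a = g) ∨ (∃ a, τ a = g))
    (φ : A →+ ZMod 17 × ZMod 17) (hφ : Function.Surjective φ)
    (h : TripleProductProperty S T U)
    (hS₀ : (univ.filter fun a : A => ρ a ∈ S).card = 1) (hS₁ : (univ.filter fun a : A => τ a ∈ S).card = 1)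
    (hT : (univ.filter fun a : A => ρ a ∈ T).card = (univ.filter fun a : A => τ a ∈ T).card)
    (hU₀ : (univ.filter fun a : A => ρ a ∈ U).card = 6) (hU₁ : (univ.filter fun a : A => τ a ∈ U).card = 6)
    (hV : 3 * (S.card * T.card * U.card) + 8 = 8 * Fintype.card A) : False :=
  haveI : Fact (Nat.Prime 17) := ⟨by decide⟩
  no_law_cube_1d_e_of_onto_zpzp_of_cover (9 : ZMod 17) half_zmod17 tableZ17s6v tableZ17s6v_cert ⟨17, by decide⟩ ⟨1, by decide⟩
    rfl rfl exists_table_entry_17_6s hρρ hρτ hτρ hττ hρ hτ hne hsurj φ hφ h hS₀ hS₁ hT hU₀ hU₁ hV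

end Summit.MatrixMultiplication.OmegaCensus
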